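import Summits.BirchSwinnertonDyer.BirchSwinnertonDyer.Theorems.ManinLocalTwoThreeKummerDiamondCyclotomicSigns
import Summits.BirchSwinnertonDyer.BirchSwinnertonDyer.Theorems.ManinLocalTwoThreeComplexAutConj
import HarnessLib

/-!
# Reading the odd Kummer classes `h₁`, `h₂` of PROPOSITION A as `2`-descent square classes (D6 ⟹ D7 of the LEAD line `kummer_diamond`)
(route `ManinLocalTwoThree`, crux C2 `ManinOddAtFour` stmt-BirchSwinnertonDyer-22967; cell bsd-f2-manin, C2/C3 LEAD p1 gen 20;
`--supports stmt-BirchSwinnertonDyer-22967`; line card `Cruxes/ManinOddAtFour/Lines/kummer_diamond.md`)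

ABSTRACT in the point group `V` (instantiated with `W₀(ℂ)` by the assembly file).  A Kummer class `κ : Aut(ℂ/ℚ) → V` of a half of a
rational `2`-torsion point comes (LEAD `…KummerDiamondHalvingCocycle`) with square roots `w₁, w₂` of its `2`-descent pair `(δ₁, δ₂)` and the
SIGN TABLE `σw₁ = w₁ ↔ κσ ∈ {0, T₁}`, `σw₂ = w₂ ↔ κσ ∈ {0, T₂}`.  p2's `StepTwo.propositionA_complex` says every odd class is `h₁` or `h₂`,
with `h₂σ ∈ {0, v}`, `h₂σ = 0 ↔ d □ mod p`, `h₁σ = h₁τ ↔ d ≡ e (8)`, `h₁(conj) = h₂(conj) = v` (`σ(e^{2πi/N}) = e^{2πi d/N}`).  Here: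

* `cocycle_conj_eq` — ODDNESS: if `δ₁ > 0 > δ₂` then `κ(conj) = T₁` (so `κ` is odd and `v = T₁`);
* `reading_of_h₂` — if `κσ ∈ {0, T₁}` always and `κσ = 0 ↔ d □ mod p` (`κ = h₂`, `v = T₁`), then `δ₁ ≡ 1`, `δ₂ ≡ −p` mod squares;
* `residue_of_T₂`, `exists_hit_T₂` — for `κ = h₁`: some `σ₂` has `κσ₂ = T₂`, and its exponent is `≡ 3` or `≡ 5 (mod 8)`;
* `reading_of_h₁` — if `κ = h₁` (`κ 1 = 0`, `κ(conj) = T₁`, the mod-`8` law) then `δ₁ ≡ 2` and `δ₂ ≡ −1` (exponent `5`) resp. `δ₂ ≡ −2`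
  (exponent `3`) mod squares — via the Kummer witnesses `√2, i, i√2, g_p` of `…KummerDiamondCyclotomicSigns`.

These are exactly the hypotheses `hT₁`/`hT₂` of D7 `KummerDiamondCases.hasFreyTwistShape_of_legendre_descent_cases` once instantiated.  UNCONDITIONAL;
no definitions, no sorry.  Nothing about E-es-185, C2, Manin's conjecture or BSD is proved here.
[cite: SilvermanAEC2009, Thm. X.1.1 and Prop. X.1.4] [cite: Stevens1989, §2]
-/

set_option autoImplicit false
-- lint-debt: the directory name repeats the summit name (sibling precedent `ManinLocalTwoThreeKummerDiamondCyclotomicSigns.lean`)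
set_option linter.dupNamespace false

noncomputable section

open scoped Classical
open Complex WeierstrassCurve.Affine

namespace Summit.BirchSwinnertonDyer.BirchSwinnertonDyer.Theorems.ManinLocalTwoThree.DescentDictionary

variable {V : Type*} [AddCommGroup V] {N : ℕ} [NeZero N]

/-! ## §1 The exponents of `1` and of complex conjugation; parity of exponents -/

omit [NeZero N] in
/-- The identity has exponent `1`. [folklore] -/
theorem pair_one : (((1 : ℤ) * 1 : ℤ) : ZMod N) = 1 ∧
    (1 : ℂ ≃ₐ[ℚ] ℂ) (exp (2 * Real.pi * I / N)) = exp (2 * Real.pi * I * ((1 : ℤ) : ℂ) / N) := by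
  refine ⟨by push_cast; ring, ?_⟩
  rw [AlgEquiv.one_apply]; congr 1; push_cast; ring

omit [NeZero N] in
/-- Complex conjugation has exponent `−1`. [folklore] -/
theorem pair_conj : (((-1 : ℤ) * (-1) : ℤ) : ZMod N) = 1 ∧
    (Complex.conjAe.restrictScalars ℚ : ℂ ≃ₐ[ℚ] ℂ) (exp (2 * Real.pi * I / N)) = exp (2 * Real.pi * I * ((-1 : ℤ) : ℂ) / N) :=
  ⟨by push_cast; ring, StepTwo.conj_exp_two_pi_I_div⟩

/-- An exponent is odd when `8 ∣ N`: its residue mod `8` is `1, 3, 5` or `7`. [folklore] -/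
theorem zmod_eight_cases (h8 : 8 ∣ N) {σ : ℂ ≃ₐ[ℚ] ℂ} {d d' : ℤ} (hdd' : ((d * d' : ℤ) : ZMod N) = 1)
    (hσ : σ (exp (2 * Real.pi * I / N)) = exp (2 * Real.pi * I * d / N)) :
    (d : ZMod 8) = 1 ∨ (d : ZMod 8) = 3 ∨ (d : ZMod 8) = 5 ∨ (d : ZMod 8) = 7 := by
  obtain ⟨d₀, -, hd₀, hcop⟩ := CyclotomicSigns.exists_natExponent hdd' hσ
  rw [← CyclotomicSigns.zmod_eight_eq_of_zmod_eq h8 hd₀]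
  rcases CyclotomicSigns.mod_eight_of_coprime h8 hcop with h | h | h | h
  · exact Or.inl ((CyclotomicSigns.natCast_zmod_eight_eq_iff d₀ 1 (by norm_num)).mpr h)
  · exact Or.inr (Or.inl (by exact_mod_cast (CyclotomicSigns.natCast_zmod_eight_eq_iff d₀ 3 (by norm_num)).mpr h))
  · exact Or.inr (Or.inr (Or.inl (by exact_mod_cast (CyclotomicSigns.natCast_zmod_eight_eq_iff d₀ 5 (by norm_num)).mpr h)))
  · exact Or.inr (Or.inr (Or.inr (by exact_mod_cast (CyclotomicSigns.natCast_zmod_eight_eq_iff d₀ 7 (by norm_num)).mpr h)))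

/-! ## §2 Oddness: `κ(conj) = T₁` when `δ₁ > 0 > δ₂` -/

omit [NeZero N] in
/-- **The class of a half of `T₁` (or `T₂`) is ODD, with value `T₁` at complex conjugation**, when its descent pair has `δ₁ > 0 > δ₂`
(true for `e₁ < e₂ < e₃`: `δ(T₁) = ((e₁−e₂)(e₁−e₃), e₁−e₂)`, `δ(T₂) = (e₂−e₁, (e₂−e₁)(e₂−e₃))`): `conj` fixes `w₁ = √δ₁` and negates
`w₂ = √δ₂`. [cite: SilvermanAEC2009, Thm. X.1.1] -/
theorem cocycle_conj_eq {T₁ T₂ T₃ : V} (κ : (ℂ ≃ₐ[ℚ] ℂ) → V) {δ₁ δ₂ : ℚ} (hδ₁ : 0 < δ₁) (hδ₂ : δ₂ < 0)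
    {w₁ w₂ : ℂ} (hw₁ : w₁ ^ 2 = (δ₁ : ℂ)) (hw₂ : w₂ ^ 2 = (δ₂ : ℂ))
    (htab : ∀ σ : ℂ ≃ₐ[ℚ] ℂ, (κ σ = 0 ∨ κ σ = T₁ ∨ κ σ = T₂ ∨ κ σ = T₃) ∧ (σ w₁ = w₁ ↔ (κ σ = 0 ∨ κ σ = T₁)) ∧
      (σ w₂ = w₂ ↔ (κ σ = 0 ∨ κ σ = T₂))) :
    κ (Complex.conjAe.restrictScalars ℚ : ℂ ≃ₐ[ℚ] ℂ) = T₁ := by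
  obtain ⟨-, h₁, h₂⟩ := htab (Complex.conjAe.restrictScalars ℚ : ℂ ≃ₐ[ℚ] ℂ)
  have hw₂0 : w₂ ≠ 0 := by
    intro h0; rw [h0, zero_pow two_ne_zero] at hw₂; exact hδ₂.ne (by exact_mod_cast hw₂.symm)
  have hc₁ : (Complex.conjAe.restrictScalars ℚ : ℂ ≃ₐ[ℚ] ℂ) w₁ = w₁ := by
    simp only [AlgEquiv.coe_restrictScalars, Complex.conjAe_coe]
    exact ComplexAut.conj_eq_self_of_sq_eq_pos hδ₁ hw₁
  have hc₂ : (Complex.conjAe.restrictScalars ℚ : ℂ ≃ₐ[ℚ] ℂ) w₂ ≠ w₂ := by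
    simp only [AlgEquiv.coe_restrictScalars, Complex.conjAe_coe]
    rw [ComplexAut.conj_eq_neg_of_sq_eq_neg hδ₂ hw₂]
    intro h; exact hw₂0 (by linear_combination -h / 2)
  rcases h₁.mp hc₁ with h | h
  · exact absurd (Or.inl h) (fun h' ↦ hc₂ (h₂.mpr h'))
  · exact h

/-! ## §3 Reading the class `h₂ = v ⊗ ψ_{−p}` -/

/-- **Reading of `h₂`.**  If the class `κ` with descent pair `(δ₁, δ₂)` takes only the values `0, T₁` and `κσ = 0 ↔ d` is a square mod `p`
(`p ≡ 3 (mod 4)` an odd prime dividing `N`), then `δ₁` is a square and `δ₂ ≡ −p` mod squares. [cite: SilvermanAEC2009, Thm. X.1.1] -/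
theorem reading_of_h₂ {p : ℕ} (hp : p.Prime) (hp4 : p % 4 = 3) (hpN : p ∣ N) {T₁ T₂ : V} (hT₂0 : T₂ ≠ 0) (hT₂₁ : T₂ ≠ T₁)
    (κ : (ℂ ≃ₐ[ℚ] ℂ) → V) {δ₁ δ₂ : ℚ} (hδ₂ : δ₂ ≠ 0) {w₁ w₂ : ℂ} (hw₁ : w₁ ^ 2 = (δ₁ : ℂ)) (hw₂ : w₂ ^ 2 = (δ₂ : ℂ))
    (htab₁ : ∀ σ : ℂ ≃ₐ[ℚ] ℂ, σ w₁ = w₁ ↔ (κ σ = 0 ∨ κ σ = T₁)) (htab₂ : ∀ σ : ℂ ≃ₐ[ℚ] ℂ, σ w₂ = w₂ ↔ (κ σ = 0 ∨ κ σ = T₂))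
    (hval : ∀ σ : ℂ ≃ₐ[ℚ] ℂ, κ σ = 0 ∨ κ σ = T₁)
    (hsq : ∀ (σ : ℂ ≃ₐ[ℚ] ℂ) (d d' : ℤ), ((d * d' : ℤ) : ZMod N) = 1 →
      σ (exp (2 * Real.pi * I / N)) = exp (2 * Real.pi * I * d / N) → (κ σ = 0 ↔ IsSquare (d : ZMod p))) :
    sqClass δ₁ = 1 ∧ sqClass δ₂ = sqClass (-(p : ℚ)) := by
  constructor
  · obtain ⟨b, hb⟩ := ComplexAut.exists_sq_eq_of_forall_algEquiv_apply_eq δ₁ w₁ hw₁ (fun σ ↦ (htab₁ σ).mpr (hval σ))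
    rw [← hb, sqClass_sq]
  · obtain ⟨g, hg, hgfix⟩ := CyclotomicSigns.exists_kummerWitness_neg_prime (N := N) hp hp4 hpN
    have hp0 : (-(p : ℚ)) ≠ 0 := neg_ne_zero.mpr (by exact_mod_cast hp.ne_zero)
    refine CyclotomicSigns.sqClass_eq_of_fixed_iff hδ₂ hp0 hw₂ hg fun σ ↦ ?_
    obtain ⟨d, d', hdd', hσ⟩ := StepTwo.exists_inv_pair_of_algEquiv (N := N) σ
    rw [htab₂ σ, hgfix σ d d' hdd' hσ, ← hsq σ d d' hdd' hσ]
    constructor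
    · rintro (h | h)
      · exact h
      · exfalso; rcases hval σ with h' | h'
        · exact hT₂0 (h.symm.trans h')
        · exact hT₂₁ (h.symm.trans h')
    · exact fun h ↦ Or.inl h

/-! ## §4 Reading the class `h₁ : (ℤ/8)ˣ ⥲ {0, T₁, T₂, T₃}` -/

/-- **Some `σ` hits `T₂`**: if `κ` is onto a set of `≥ 4` values (`im ϖ`) and takes values in `{0, T₁, T₂, T₃}`, then `κσ₂ = T₂` for some `σ₂`.
[folklore] -/
theorem exists_hit_T₂ {ι : Type*} {T₁ T₂ T₃ : V} (κ : (ℂ ≃ₐ[ℚ] ℂ) → V) (w : ι → V) (hK : 4 ≤ (Set.range w).ncard)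
    (honto : ∀ i, ∃ σ : ℂ ≃ₐ[ℚ] ℂ, κ σ = w i) (hvals : ∀ σ : ℂ ≃ₐ[ℚ] ℂ, κ σ = 0 ∨ κ σ = T₁ ∨ κ σ = T₂ ∨ κ σ = T₃) :
    ∃ σ : ℂ ≃ₐ[ℚ] ℂ, κ σ = T₂ := by
  by_contra hne
  simp only [not_exists] at hne
  have hsub : Set.range w ⊆ ({0, T₁, T₃} : Set V) := by
    rintro _ ⟨i, rfl⟩
    obtain ⟨σ, hσ⟩ := honto i
    rw [← hσ]
    simp only [Set.mem_insert_iff, Set.mem_singleton_iff]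
    rcases hvals σ with h | h | h | h
    · exact Or.inl h
    · exact Or.inr (Or.inl h)
    · exact absurd h (hne σ)
    · exact Or.inr (Or.inr h)
  have h3 : ({0, T₁, T₃} : Set V).ncard ≤ 3 := by
    refine (Set.ncard_insert_le _ _).trans ?_
    have := Set.ncard_insert_le T₁ ({T₃} : Set V)
    rw [Set.ncard_singleton] at this
    omega
  have := Set.ncard_le_ncard hsub (Set.toFinite _)
  omega

/-- **The exponent of a `σ₂` with `h₁σ₂ = T₂` is `≡ 3` or `≡ 5 (mod 8)`** (it is odd, `≢ 1` since `h₁(1) = 0 ≠ T₂`, `≢ −1` since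
`h₁(conj) = T₁ ≠ T₂`). [folklore] -/
theorem residue_of_T₂ (h8 : 8 ∣ N) {T₁ T₂ : V} (hT₂0 : T₂ ≠ 0) (hT₂₁ : T₂ ≠ T₁) (κ : (ℂ ≃ₐ[ℚ] ℂ) → V)
    (hmod8 : ∀ (σ τ : ℂ ≃ₐ[ℚ] ℂ) (d d' e e' : ℤ), ((d * d' : ℤ) : ZMod N) = 1 →
      σ (exp (2 * Real.pi * I / N)) = exp (2 * Real.pi * I * d / N) → ((e * e' : ℤ) : ZMod N) = 1 →
      τ (exp (2 * Real.pi * I / N)) = exp (2 * Real.pi * I * e / N) → (κ σ = κ τ ↔ (d : ZMod 8) = (e : ZMod 8)))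
    (hone : κ 1 = 0) (hconj : κ (Complex.conjAe.restrictScalars ℚ : ℂ ≃ₐ[ℚ] ℂ) = T₁)
    {σ₂ : ℂ ≃ₐ[ℚ] ℂ} {d₂ d₂' : ℤ} (hdd₂ : ((d₂ * d₂' : ℤ) : ZMod N) = 1)
    (hσ₂ : σ₂ (exp (2 * Real.pi * I / N)) = exp (2 * Real.pi * I * d₂ / N)) (hκ₂ : κ σ₂ = T₂) :
    (d₂ : ZMod 8) = 3 ∨ (d₂ : ZMod 8) = 5 := by
  rcases zmod_eight_cases h8 hdd₂ hσ₂ with h | h | h | h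
  · exfalso
    have := (hmod8 σ₂ 1 d₂ d₂' 1 1 hdd₂ hσ₂ pair_one.1 pair_one.2).mpr (by rw [h]; push_cast; rfl)
    rw [hκ₂, hone] at this; exact hT₂0 this
  · exact Or.inl h
  · exact Or.inr h
  · exfalso
    have := (hmod8 σ₂ _ d₂ d₂' (-1) (-1) hdd₂ hσ₂ pair_conj.1 pair_conj.2).mpr (by rw [h]; decide)
    rw [hκ₂, hconj] at this; exact hT₂₁ this

/-- **Reading of `h₁`.**  If the class `κ` with descent pair `(δ₁, δ₂)` and the sign table obeys the mod-`8` law of `h₁` (`κσ = κτ ↔ d ≡ e (8)`),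
`κ(1) = 0`, `κ(conj) = T₁`, and `κσ₂ = T₂` for an exponent `d₂`, then `δ₁ ≡ 2`, and `δ₂ ≡ −1` if `d₂ ≡ 5 (8)`, `δ₂ ≡ −2` if `d₂ ≡ 3 (8)`
(mod squares). [cite: SilvermanAEC2009, Thm. X.1.1] -/
theorem reading_of_h₁ (h8 : 8 ∣ N) {T₁ T₂ : V} (κ : (ℂ ≃ₐ[ℚ] ℂ) → V)
    {δ₁ δ₂ : ℚ} (hδ₁ : δ₁ ≠ 0) (hδ₂ : δ₂ ≠ 0) {w₁ w₂ : ℂ} (hw₁ : w₁ ^ 2 = (δ₁ : ℂ)) (hw₂ : w₂ ^ 2 = (δ₂ : ℂ))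
    (htab₁ : ∀ σ : ℂ ≃ₐ[ℚ] ℂ, σ w₁ = w₁ ↔ (κ σ = 0 ∨ κ σ = T₁)) (htab₂ : ∀ σ : ℂ ≃ₐ[ℚ] ℂ, σ w₂ = w₂ ↔ (κ σ = 0 ∨ κ σ = T₂))
    (hmod8 : ∀ (σ τ : ℂ ≃ₐ[ℚ] ℂ) (d d' e e' : ℤ), ((d * d' : ℤ) : ZMod N) = 1 →
      σ (exp (2 * Real.pi * I / N)) = exp (2 * Real.pi * I * d / N) → ((e * e' : ℤ) : ZMod N) = 1 →
      τ (exp (2 * Real.pi * I / N)) = exp (2 * Real.pi * I * e / N) → (κ σ = κ τ ↔ (d : ZMod 8) = (e : ZMod 8)))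
    (hone : κ 1 = 0) (hconj : κ (Complex.conjAe.restrictScalars ℚ : ℂ ≃ₐ[ℚ] ℂ) = T₁)
    {σ₂ : ℂ ≃ₐ[ℚ] ℂ} {d₂ d₂' : ℤ} (hdd₂ : ((d₂ * d₂' : ℤ) : ZMod N) = 1)
    (hσ₂ : σ₂ (exp (2 * Real.pi * I / N)) = exp (2 * Real.pi * I * d₂ / N)) (hκ₂ : κ σ₂ = T₂) :
    sqClass δ₁ = sqClass (2 : ℚ) ∧ ((d₂ : ZMod 8) = 5 → sqClass δ₂ = sqClass (-1 : ℚ)) ∧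
      ((d₂ : ZMod 8) = 3 → sqClass δ₂ = sqClass (-2 : ℚ)) := by
  -- the values of `κ` in terms of the exponent
  have key : ∀ (σ : ℂ ≃ₐ[ℚ] ℂ) (d d' : ℤ), ((d * d' : ℤ) : ZMod N) = 1 →
      σ (exp (2 * Real.pi * I / N)) = exp (2 * Real.pi * I * d / N) →
      (κ σ = 0 ↔ (d : ZMod 8) = 1) ∧ (κ σ = T₁ ↔ (d : ZMod 8) = 7) ∧ (κ σ = T₂ ↔ (d : ZMod 8) = (d₂ : ZMod 8)) := by
    intro σ d d' hdd' hσ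
    refine ⟨?_, ?_, ?_⟩
    · rw [← hone, hmod8 σ 1 d d' 1 1 hdd' hσ pair_one.1 pair_one.2]; push_cast; rfl
    · rw [← hconj, hmod8 σ _ d d' (-1) (-1) hdd' hσ pair_conj.1 pair_conj.2]
      constructor
      · intro h; rw [h]; decide
      · intro h; rw [h]; decide
    · rw [← hκ₂, hmod8 σ σ₂ d d' d₂ d₂' hdd' hσ hdd₂ hσ₂]
  refine ⟨?_, fun h5 ↦ ?_, fun h3 ↦ ?_⟩
  · obtain ⟨g, hg, hgfix⟩ := CyclotomicSigns.exists_kummerWitness_two (N := N) h8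
    refine CyclotomicSigns.sqClass_eq_of_fixed_iff hδ₁ two_ne_zero hw₁ hg fun σ ↦ ?_
    obtain ⟨d, d', hdd', hσ⟩ := StepTwo.exists_inv_pair_of_algEquiv (N := N) σ
    obtain ⟨k0, k1, -⟩ := key σ d d' hdd' hσ
    rw [htab₁ σ, hgfix σ d d' hdd' hσ, k0, k1]
  · obtain ⟨g, hg, hgfix⟩ := CyclotomicSigns.exists_kummerWitness_neg_one (N := N) h8
    refine CyclotomicSigns.sqClass_eq_of_fixed_iff hδ₂ (by norm_num) hw₂ hg fun σ ↦ ?_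
    obtain ⟨d, d', hdd', hσ⟩ := StepTwo.exists_inv_pair_of_algEquiv (N := N) σ
    obtain ⟨k0, -, k2⟩ := key σ d d' hdd' hσ
    rw [htab₂ σ, hgfix σ d d' hdd' hσ, k0, k2, h5]
  · obtain ⟨g, hg, hgfix⟩ := CyclotomicSigns.exists_kummerWitness_neg_two (N := N) h8
    refine CyclotomicSigns.sqClass_eq_of_fixed_iff hδ₂ (by norm_num) hw₂ hg fun σ ↦ ?_
    obtain ⟨d, d', hdd', hσ⟩ := StepTwo.exists_inv_pair_of_algEquiv (N := N) σ
    obtain ⟨k0, -, k2⟩ := key σ d d' hdd' hσ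
    rw [htab₂ σ, hgfix σ d d' hdd' hσ, k0, k2, h3]

end Summit.BirchSwinnertonDyer.BirchSwinnertonDyer.Theorems.ManinLocalTwoThree.DescentDictionary

end
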